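import Literature.Geometry.Riemannian.ThreeShrinkerSectionalNonneg
import Literature.Geometry.Riemannian.ShrinkerEntropyProofs
import HarnessLib

/-!
# A three-dimensional shrinker with `S ≥ 3/2 + δ` off a compact set has finite volume
# (Munteanu–Wang 2017, proof of Thm. 2, step 3)

**Theorem** (O. Munteanu, J. Wang, *Positively curved shrinking Ricci solitons are compact*,
J. Differential Geom. 106 (2017), proof of Thm. 2, the concluding step, specialised to dimension
three). Let `(N, h, φ)` be a complete connected three-dimensional gradient shrinking Ricci soliton,
`Ric + Hess φ = ½ h`, normalised by `S + |∇φ|² = φ`. If `S ≥ 3/2 + δ` on `{ρ ≤ φ}` for some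
`δ > 0`, then `Vol(N, h) < ∞`.

* **`ThreeShrinker.integral_cutoff_mul_sub_scalarCurvature_nonneg`** — the cut-off integration of
  the trace identity `S + Δφ = 3/2`: for a smooth non-increasing profile `η` vanishing on `[2, ∞)`
  and every level `T`, `0 ≤ ∫ η(φ − T) (3/2 − S) dV` (Green's first identity for the compactly
  supported `η(φ − T)`, `GreenIdentityCompactSupport.lean`, and `h⁻¹(d η(φ − T), dφ) =
  η'(φ − T) |∇φ|² ≤ 0`);
* **`ThreeShrinker.measureReal_potential_le_le`** — hence, splitting `N = {φ < ρ} ∪ {ρ ≤ φ}` and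
  using `S ≥ 0` (Z.-H. Zhang / B.-L. Chen, `shrinkerScalarCurvature_nonneg_holds`),
  `δ · Vol{φ ≤ T} ≤ (3/2 + δ) · Vol{φ < ρ}` for every `T`;
* **`ThreeShrinker.riemVolume_univ_lt_top_of_scalarCurvature_ge`** — exhausting `N` by the compact
  sub-level sets `{φ ≤ k}` (properness of the potential, Haslhofer–Müller 2011, Lemma 2.1,
  `isCompact_potential_le`), `Vol(N) ≤ (3/2 + δ) δ⁻¹ Vol{φ < ρ} < ∞`.

Everything is proved; no definition and no named fact is introduced.

## References

* O. Munteanu, J. Wang, *Positively curved shrinking Ricci solitons are compact*, J. Differential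
  Geom. 106 (2017) 499–505 (arXiv:1504.07898), proof of Thm. 2. [MunteanuWang2017]
* H.-D. Cao, D. Zhou, *On complete gradient shrinking Ricci solitons*, J. Differential Geom. 85
  (2010) 175–185, Lemma 3.1 / Thm. 1.2 (the same cut-off integration of `S + Δf = n/2`).
  [CaoZhou2010]
* R. Haslhofer, R. Müller, GAFA 21 (2011), Lemma 2.1. [HaslhoferMuller2011]
* Z.-H. Zhang, Proc. AMS 137 (2009), Thm. 1.3. [Zhang2009]
-/

noncomputable section

open Set Filter Module Metric MeasureTheory
open scoped Manifold ContDiff Topology NNReal ENNReal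

namespace Literature.Geometry.Riemannian

open Lorentzian Lorentzian.PseudoRiemannianMetric

namespace ThreeShrinker

variable {N : Type} [TopologicalSpace N] [T2Space N] [SecondCountableTopology N]
  [ChartedSpace (EuclideanSpace ℝ (Fin 3)) N] [IsManifold (𝓡 3) ∞ N] [ConnectedSpace N]
  [T3Space N] [MeasurableSpace N] [BorelSpace N]
  (h : PseudoRiemannianMetric (𝓡 3) ∞ (EuclideanSpace ℝ (Fin 3)) (TangentSpace (𝓡 3) : N → Type _))
  [h.HasLeviCivita] (φ : N → ℝ) (hh : h.IsRiemannian)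

omit [SecondCountableTopology N] [ConnectedSpace N] in
include hh in
/-- **The trace identity `S + Δφ = 3/2`, integrated against a cut-off of the potential**
(Munteanu–Wang 2017, proof of Thm. 2; Cao–Zhou 2010, Lemma 3.1): for `h` Riemannian with
`Ric + Hess φ = ½ h`, `φ` smooth with compact sub-level sets, a smooth non-increasing profile `η`
vanishing on `[2, ∞)` and a level `T`, `0 ≤ ∫ η(φ − T) (3/2 − S) dV`. Indeed
`∫ η(φ − T) Δφ = −∫ h⁻¹(d η(φ − T), dφ) = −∫ η'(φ − T) |∇φ|² ≥ 0` by Green's first identity for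
the compactly supported `η(φ − T)`. [cite: MunteanuWang2017, Thm. 2] -/
theorem integral_cutoff_mul_sub_scalarCurvature_nonneg
    (hφ : ContMDiff (𝓡 3) 𝓘(ℝ, ℝ) ∞ φ)
    (hsol : ∀ (x : N) (X Y : TangentSpace (𝓡 3) x),
      h.ricci x X Y + h.hessian φ x X Y = (1 / 2 : ℝ) * h.val x X Y)
    (hK : ∀ c : ℝ, IsCompact {y : N | φ y ≤ c}) {η : ℝ → ℝ} (hηs : ContDiff ℝ ∞ η)
    (hη0 : ∀ t, 2 ≤ t → η t = 0) (hηa : Antitone η) (T : ℝ) :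
    0 ≤ ∫ x, η (φ x - T) * (3 / 2 - h.scalarCurvature x) ∂h.riemVolume := by
  classical
  -- topology supplied by the exhaustion
  haveI : SigmaCompactSpace N := ⟨⟨fun k : ℕ ↦ {x | φ x ≤ k}, fun k ↦ hK k,
    eq_univ_of_forall fun x ↦ mem_iUnion.2 (exists_nat_ge (φ x))⟩⟩
  haveI : WeaklyLocallyCompactSpace N := ⟨fun x ↦ ⟨{y | φ y ≤ φ x + 1}, hK _, by
    have hopen : IsOpen {y | φ y < φ x + 1} := isOpen_lt hφ.continuous continuous_const
    exact mem_of_superset (hopen.mem_nhds (show x ∈ {y | φ y < φ x + 1} from lt_add_one (φ x)))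
      fun y hy ↦ show φ y ≤ φ x + 1 from le_of_lt hy⟩⟩
  -- the cut-off `u = η (φ - T)`
  set ζ : ℝ → ℝ := fun t ↦ η (t - T) with hζ
  have hζs : ContDiff ℝ ∞ ζ := hηs.comp (contDiff_id.sub contDiff_const)
  have hζd : ∀ t, HasDerivAt ζ (deriv η (t - T)) t := fun t ↦ by
    have h1 : HasDerivAt (fun s : ℝ ↦ s - T) 1 t := (hasDerivAt_id t).sub_const T
    have h2 : HasDerivAt η (deriv η (t - T)) (t - T) :=
      (hηs.differentiable (by norm_num) _).hasDerivAt
    simpa [hζ, Function.comp_def] using h2.comp t h1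
  set u : N → ℝ := fun x ↦ ζ (φ x) with hu
  have hus : ContMDiff (𝓡 3) 𝓘(ℝ, ℝ) 1 u := (hζs.comp_contMDiff hφ).of_le ENat.LEInfty.out
  have huc : HasCompactSupport u := by
    refine HasCompactSupport.intro (hK (T + 2)) fun x hx ↦ ?_
    have hx' : T + 2 < φ x := lt_of_not_ge hx
    exact hη0 _ (by linarith)
  -- Green's identity for `u` against `φ`
  have h2 : ContMDiff (𝓡 3) 𝓘(ℝ, ℝ) 2 φ := hφ.of_le ENat.LEInfty.out
  have hGreen : ∫ x, u x * h.dalembertian φ x ∂h.riemVolume =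
      -∫ x, h.innerDual x (mvfderiv (𝓡 3) u x).toLinearMap
        (mvfderiv (𝓡 3) φ x).toLinearMap ∂h.riemVolume := by
    haveI := (PseudoRiemannianMetric.ofRiemannian (h.toContMDiffRiemannianMetric hh)).hasLeviCivita
    have h1 := integral_mul_dalembertian_eq_neg_integral_innerDual_of_hasCompactSupport
      (h.toContMDiffRiemannianMetric hh) hus huc h2
    rw [PseudoRiemannianMetric.riemVolume_eq hh]
    exact h1
  -- identify both integrands
  have hL : ∀ x, u x * h.dalembertian φ x = η (φ x - T) * (3 / 2 - h.scalarCurvature x) :=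
    fun x ↦ by
    have h1 := CarrilloNi2009_shrinkerLSI.scalarCurvature_add_dalembertian hsol x
    rw [Nat.cast_ofNat] at h1
    rw [show h.dalembertian φ x = 3 / 2 - h.scalarCurvature x by linarith]
  have hRt : ∀ x, h.innerDual x (mvfderiv (𝓡 3) u x).toLinearMap
      (mvfderiv (𝓡 3) φ x).toLinearMap = deriv η (φ x - T) * h.gradSq φ x := fun x ↦ by
    have hφx : MDifferentiableAt (𝓡 3) 𝓘(ℝ, ℝ) φ x := hφ.mdifferentiableAt (by norm_num)
    have hdu : (mvfderiv (𝓡 3) u x).toLinearMap =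
        (deriv η (φ x - T)) • (mvfderiv (𝓡 3) φ x).toLinearMap := by
      ext v
      have := mvfderiv_real_comp_apply (I := 𝓡 3) (hζd (φ x)) hφx v
      simpa [hu, Function.comp_def] using this
    rw [hdu]
    simp only [PseudoRiemannianMetric.innerDual, LinearMap.smul_apply, smul_eq_mul,
      PseudoRiemannianMetric.gradSq]
  simp_rw [hL, hRt] at hGreen
  rw [hGreen, ← integral_neg]
  refine integral_nonneg fun x ↦ ?_
  have hd : deriv η (φ x - T) ≤ 0 := hηa.deriv_nonpos
  have hG : 0 ≤ h.gradSq φ x := h.gradSq_nonneg hh φ x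
  simpa using mul_nonneg (neg_nonneg.2 hd) hG

/-- **The volume of the sub-level sets of the potential is bounded** (Munteanu–Wang 2017, proof of
Thm. 2, step 3): on a complete connected normalised three-dimensional gradient shrinker with
`S ≥ 3/2 + δ` on `{ρ ≤ φ}`, `δ > 0`, every sub-level set satisfies
`δ · Vol{φ ≤ T} ≤ (3/2 + δ) · Vol{φ < ρ}`. From `0 ≤ ∫ η(φ − T)(3/2 − S)`
(`integral_cutoff_mul_sub_scalarCurvature_nonneg`, `η = 1` on `(−∞, 1]`) and the pointwise bound
`δ 𝟙_{φ ≤ T} + η(φ − T)(3/2 − S) ≤ (3/2 + δ) 𝟙_{φ < ρ}` (`S ≥ 0` on `{φ < ρ}`, `S ≥ 3/2 + δ` on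
`{ρ ≤ φ}`, `0 ≤ η ≤ 1`). [cite: MunteanuWang2017, Thm. 2] -/
theorem measureReal_potential_le_le
    (hcpl : ∀ (x : N) (r : ℝ≥0), IsCompact {y : N | h.edist hh x y ≤ r})
    (hφ : ContMDiff (𝓡 3) 𝓘(ℝ, ℝ) ∞ φ)
    (hsol : ∀ (x : N) (X Y : TangentSpace (𝓡 3) x),
      h.ricci x X Y + h.hessian φ x X Y = (1 / 2 : ℝ) * h.val x X Y)
    (hnorm : ∀ x : N, h.scalarCurvature x + h.gradSq φ x = φ x)
    {δ ρ : ℝ} (hδ : 0 < δ)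
    (hS : ∀ x : N, ρ ≤ φ x → 3 / 2 + δ ≤ h.scalarCurvature x) (T : ℝ) :
    δ * h.riemVolume.real {y : N | φ y ≤ T} ≤
      (3 / 2 + δ) * h.riemVolume.real {y : N | φ y < ρ} := by
  classical
  have hR0 : ∀ y : N, 0 ≤ h.scalarCurvature y :=
    shrinkerScalarCurvature_nonneg_holds 3 N h φ hh hcpl hφ hsol hnorm
  have hK : ∀ c : ℝ, IsCompact {y : N | φ y ≤ c} :=
    isCompact_potential_le h φ hh hcpl hφ hsol hnorm hR0
  haveI := CarrilloNi2009_shrinkerLSI.isFiniteMeasureOnCompacts_riemVolume hh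
  obtain ⟨η, hηs, hη1, hη0, hη01, hηa⟩ := CarrilloNi2009_shrinkerLSI.exists_antitone_cutoffProfile
  have hint := integral_cutoff_mul_sub_scalarCurvature_nonneg h φ hh hφ hsol hK hηs hη0 hηa T
  -- notation
  set A : Set N := {y | φ y < ρ} with hA
  set B : Set N := {y | φ y ≤ T} with hB
  have hAm : MeasurableSet A := (isOpen_lt hφ.continuous continuous_const).measurableSet
  have hBm : MeasurableSet B := (isClosed_le hφ.continuous continuous_const).measurableSet
  have hAfin : h.riemVolume A < ⊤ :=
    (measure_mono (fun y (hy : φ y < ρ) ↦ show φ y ≤ ρ from le_of_lt hy)).trans_lt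
      (hK ρ).measure_lt_top
  have hBfin : h.riemVolume B < ⊤ := (hK T).measure_lt_top
  set F : N → ℝ := fun x ↦ η (φ x - T) * (3 / 2 - h.scalarCurvature x) with hF
  -- integrability
  have hRc : Continuous h.scalarCurvature := (contMDiff_scalarCurvature h).continuous
  have hFc : Continuous F :=
    (hηs.continuous.comp (hφ.continuous.sub continuous_const)).mul (continuous_const.sub hRc)
  have hFsupp : HasCompactSupport F := by
    refine HasCompactSupport.intro (hK (T + 2)) fun x hx ↦ ?_
    have hx' : T + 2 < φ x := lt_of_not_ge hx
    simp only [hF, hη0 _ (by linarith : (2 : ℝ) ≤ φ x - T), zero_mul]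
  have hFi : Integrable F h.riemVolume := hFc.integrable_of_hasCompactSupport hFsupp
  have hAi : Integrable (A.indicator (1 : N → ℝ)) h.riemVolume :=
    (integrable_indicator_iff hAm).2 (integrableOn_const hAfin.ne)
  have hBi : Integrable (B.indicator (1 : N → ℝ)) h.riemVolume :=
    (integrable_indicator_iff hBm).2 (integrableOn_const hBfin.ne)
  -- the pointwise bound
  have hpt : ∀ x, δ * B.indicator (1 : N → ℝ) x + F x ≤
      (3 / 2 + δ) * A.indicator (1 : N → ℝ) x := by
    intro x
    have hu0 : 0 ≤ η (φ x - T) := (hη01 _).1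
    have hu1 : η (φ x - T) ≤ 1 := (hη01 _).2
    have hBle : B.indicator (1 : N → ℝ) x ≤ η (φ x - T) := by
      by_cases hx : x ∈ B
      · rw [indicator_of_mem hx, Pi.one_apply, hη1 _ (by linarith [show φ x ≤ T from hx])]
      · rw [indicator_of_notMem hx]
        exact hu0
    by_cases hxA : x ∈ A
    · rw [indicator_of_mem hxA, Pi.one_apply, mul_one]
      have h1 : F x ≤ 3 / 2 := by
        simp only [hF]
        calc η (φ x - T) * (3 / 2 - h.scalarCurvature x)
            ≤ 1 * (3 / 2 - h.scalarCurvature x) ⊔ 0 := by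
              rcases le_or_gt 0 (3 / 2 - h.scalarCurvature x) with hc | hc
              · exact (mul_le_mul_of_nonneg_right hu1 hc).trans (le_max_left _ _)
              · exact (mul_nonpos_of_nonneg_of_nonpos hu0 hc.le).trans (le_max_right _ _)
          _ ≤ 3 / 2 := by
              refine max_le ?_ (by norm_num)
              linarith [hR0 x]
      have h2 : B.indicator (1 : N → ℝ) x ≤ 1 := hBle.trans hu1
      nlinarith
    · rw [indicator_of_notMem hxA, mul_zero]
      have hxρ : ρ ≤ φ x := not_lt.1 hxA
      have hSx := hS x hxρ
      have h1 : F x ≤ -(δ * η (φ x - T)) := by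
        simp only [hF]
        nlinarith
      nlinarith
  -- integrate
  have hI : ∫ x, (δ * B.indicator (1 : N → ℝ) x + F x) ∂h.riemVolume ≤
      ∫ x, (3 / 2 + δ) * A.indicator (1 : N → ℝ) x ∂h.riemVolume :=
    integral_mono ((hBi.const_mul δ).add hFi) (hAi.const_mul _) hpt
  rw [integral_add (hBi.const_mul δ) hFi, integral_const_mul, integral_const_mul,
    integral_indicator_one hBm, integral_indicator_one hAm] at hI
  linarith

/-- **Munteanu–Wang 2017, proof of Thm. 2, step 3 (dimension three): `S ≥ 3/2 + δ` outside a
compact set forces finite volume.** On a complete connected three-dimensional gradient shrinking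
Ricci soliton `Ric + Hess φ = ½ h`, `S + |∇φ|² = φ`, if `S ≥ 3/2 + δ` on `{ρ ≤ φ}` for some
`δ > 0` then `Vol(N, h) < ∞`: by `measureReal_potential_le_le` every compact sub-level set
`{φ ≤ T}` has volume at most `(3/2 + δ) δ⁻¹ Vol{φ < ρ}`, and these exhaust `N` (the potential is
proper, Haslhofer–Müller). (In the source this contradicts the at-least-linear volume growth of a
noncompact shrinker, Cao–Zhou 2010, Thm. 1.2.) [cite: MunteanuWang2017, Thm. 2] -/
theorem riemVolume_univ_lt_top_of_scalarCurvature_ge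
    (hcpl : ∀ (x : N) (r : ℝ≥0), IsCompact {y : N | h.edist hh x y ≤ r})
    (hφ : ContMDiff (𝓡 3) 𝓘(ℝ, ℝ) ∞ φ)
    (hsol : ∀ (x : N) (X Y : TangentSpace (𝓡 3) x),
      h.ricci x X Y + h.hessian φ x X Y = (1 / 2 : ℝ) * h.val x X Y)
    (hnorm : ∀ x : N, h.scalarCurvature x + h.gradSq φ x = φ x)
    {δ ρ : ℝ} (hδ : 0 < δ)
    (hS : ∀ x : N, ρ ≤ φ x → 3 / 2 + δ ≤ h.scalarCurvature x) :
    h.riemVolume (Set.univ : Set N) < ⊤ := by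
  classical
  have hR0 : ∀ y : N, 0 ≤ h.scalarCurvature y :=
    shrinkerScalarCurvature_nonneg_holds 3 N h φ hh hcpl hφ hsol hnorm
  have hK : ∀ c : ℝ, IsCompact {y : N | φ y ≤ c} :=
    isCompact_potential_le h φ hh hcpl hφ hsol hnorm hR0
  haveI := CarrilloNi2009_shrinkerLSI.isFiniteMeasureOnCompacts_riemVolume hh
  set C : ℝ := (3 / 2 + δ) / δ * h.riemVolume.real {y : N | φ y < ρ} with hC
  have hbound : ∀ T : ℝ, h.riemVolume {y : N | φ y ≤ T} ≤ ENNReal.ofReal C := fun T ↦ by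
    have h1 := measureReal_potential_le_le h φ hh hcpl hφ hsol hnorm hδ hS T
    have hfin : h.riemVolume {y : N | φ y ≤ T} < ⊤ := (hK T).measure_lt_top
    rw [← ENNReal.ofReal_toReal hfin.ne]
    refine ENNReal.ofReal_le_ofReal ?_
    rw [hC, div_mul_eq_mul_div, le_div_iff₀ hδ, mul_comm]
    exact h1
  have hmono : Monotone fun k : ℕ ↦ {y : N | φ y ≤ k} := fun a b hab y hy ↦
    le_trans (show φ y ≤ a from hy) (by exact_mod_cast hab)
  have huniv : (univ : Set N) = ⋃ k : ℕ, {y : N | φ y ≤ k} :=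
    (eq_univ_of_forall fun x ↦ mem_iUnion.2 (exists_nat_ge (φ x))).symm
  rw [huniv, hmono.measure_iUnion]
  exact lt_of_le_of_lt (iSup_le fun k ↦ hbound k) ENNReal.ofReal_lt_top

end ThreeShrinker

end Literature.Geometry.Riemannian

end
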